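import Summits.QuantumFields.QCD.Theorems.QuarksAsStableActionCriticalLineDiamagnetismRectFreqOpDefs
import Summits.QuantumFields.QCD.Theorems.QuarksAsStableActionCriticalLineDiamagnetismStubFrequencyDiamagnetismAux2

/-!
# Route B infrastructure for stub `stub_heavyFrequencyGain` of line `Sketch` — Lüscher's transfer-matrix form of the 2D
frequency determinant on RECTANGULAR two-tori `ℤ/L₁ × ℤ/L₂`
(crux `Summit.QuantumFields.QCD.Theses.QuarksAsStableAction.CriticalLineDiamagnetism`, item stmt-QuantumFields-9734,
static route for odd tori, Route B of the heavy-frequency gain)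

Two-length copy of `…StubFrequencyDiamagnetismAux2` (proofs kept parallel, line by line): ordering the sites of
`ℤ/L₁ × ℤ/L₂` by the first coordinate `t : ℤ/L₁` ("time", `L₁` slices), the time form `tfreqOpR A m ω₀ ω₁` is the projector
chain of `det_projChain` on the slice space `ℤ/L₂ × colour × spin` with same-time blocks `sliceOpR A m ω₀ ω₁ t`, hops
`−P⁻W_t`, `−P⁺W′_s` (`tfreqOpR_submatrix_timeSlice`); the slice data satisfy the nine commutation claims
(`slice_spin_structureR`) and the five positivity claims (`slice_claimsR`, `B_t > 0` for `m > −1`: `massHopR_posDef`); hence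
the time-slice reduction (`tfreqOpR_det_slice_reduction`) and LÜSCHER'S TRANSFER-MATRIX FORM
`det tfreqOpR = (∏_{t : ℤ/L₁} det E_t) · det(1 − ∏_{t<L₁} M_t W_t)`, `M_t > 0` (`tfreqOpR_det_transfer_form`; registered as
`rectTransferForm`).  References: M. Lüscher, Commun. Math. Phys. 54 (1977) 283; J. Smit, *Introduction to Quantum Fields on a
Lattice*, §6.5.
-/

noncomputable section

open scoped BigOperators Matrix ComplexConjugate Kronecker ComplexOrder
open Finset
open Literature.MathematicalPhysics.QuantumLattice Literature.MathematicalPhysics.QuantumFieldTheory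
  Literature.Probability.LatticeModels

namespace Summit.QuantumFields.QCD.Cruxes.CriticalLineDiamagnetism.ChessboardCellGain

namespace FrequencyDiamagnetism

open Matrix Complex
open Summit.QuantumFields.QCD.Cruxes.StableActionBridge.Sketch

/-! ### The time form is the projector chain of its slice data -/

/-- Entries of the slice operator. -/
theorem sliceOpR_apply {L₁ L₂ : ℕ} [NeZero L₁] [NeZero L₂] (A : ZMod L₁ → ZMod L₂ → Fin 4 → Matrix.unitaryGroup (Fin 3) ℂ)
    (m ω₀ ω₁ : ℝ) (t : ZMod L₁) (a b : ZMod L₂ × Fin 3 × Fin 4) :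
    sliceOpR A m ω₀ ω₁ t a b =
      (if a.1 = b.1 ∧ a.2.1 = b.2.1 then
          (((m + 4 - Real.cos ω₀ - Real.cos ω₁ : ℝ) : ℂ) * (1 : Matrix (Fin 4) (Fin 4) ℂ) a.2.2 b.2.2 +
            Complex.I * (((Real.sin ω₀ : ℝ) : ℂ) * euclideanGamma 2 a.2.2 b.2.2 +
              ((Real.sin ω₁ : ℝ) : ℂ) * euclideanGamma 1 a.2.2 b.2.2))
        else 0) -
        (1 / 2 : ℂ) *
          ((if b.1 = a.1 + 1 then
              ((1 : Matrix (Fin 4) (Fin 4) ℂ) - euclideanGamma 3) a.2.2 b.2.2 *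
                ((if a.1 = -1 then (-1 : ℂ) else 1) * (A t a.1 3 : Matrix (Fin 3) (Fin 3) ℂ) a.2.1 b.2.1)
            else 0) +
           (if a.1 = b.1 + 1 then
              ((1 : Matrix (Fin 4) (Fin 4) ℂ) + euclideanGamma 3) a.2.2 b.2.2 *
                ((if b.1 = -1 then (-1 : ℂ) else 1) * (star (A t b.1 3 : Matrix (Fin 3) (Fin 3) ℂ)) a.2.1 b.2.1)
            else 0)) := by
  obtain ⟨x, c, α⟩ := a
  obtain ⟨y, d, β⟩ := b
  rw [sliceOpR, map_add, map_sum, Matrix.add_apply, Matrix.sum_apply]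
  simp only [SliceSpin.reindex_kronecker_apply, Fin.sum_univ_three, hopCoeffR, massHopR, hop3R, Matrix.cons_val_zero,
    Matrix.cons_val_one, Matrix.cons_val_two, Matrix.head_cons, Matrix.tail_cons, Fin.succ_zero_eq_one,
    Fin.succ_one_eq_two, Matrix.sub_apply, Matrix.add_apply, Matrix.smul_apply, Matrix.diagonal_apply,
    Matrix.conjTranspose_apply, Matrix.of_apply, Matrix.one_apply, Matrix.star_apply, smul_eq_mul, star_mul',
    Prod.mk.injEq, apply_ite (star : ℂ → ℂ), star_zero, star_neg, star_one]
  have h3 : (Fin.succ (2 : Fin 3)) = 3 := rfl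
  simp only [h3]
  split_ifs <;> ring

/-- **Time-slicing of the time form.**  Reindexing the two-torus site by (first coordinate, rest), the time form
`tfreqOpR A m ω₀ ω₁` is the projector chain with same-time blocks `sliceOpR A m ω₀ ω₁ t`, forward temporal hop
`−P⁻ W_t` to row `t + 1` and backward hop `−P⁺ W′_s` from row `s + 1` to row `s` (valid for every `L₁ ≥ 1`; the three
cases are kept as separate summands, they overlap when `L₁ ≤ 2`). -/
theorem tfreqOpR_submatrix_timeSlice {L₁ L₂ : ℕ} [NeZero L₁] [NeZero L₂] (A : ZMod L₁ → ZMod L₂ → Fin 4 → Matrix.unitaryGroup (Fin 3) ℂ)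
    (m ω₀ ω₁ : ℝ) :
    (tfreqOpR A m ω₀ ω₁).submatrix (fun p : ZMod L₁ × (ZMod L₂ × Fin 3 × Fin 4) => ((p.1, p.2.1), p.2.2))
        (fun p : ZMod L₁ × (ZMod L₂ × Fin 3 × Fin 4) => ((p.1, p.2.1), p.2.2)) =
      Matrix.of fun p q : ZMod L₁ × (ZMod L₂ × Fin 3 × Fin 4) =>
        (if q.1 = p.1 then sliceOpR A m ω₀ ω₁ p.1 p.2 q.2 else 0) -
          (if q.1 = p.1 + 1 then (projM L₂ * link2R A p.1) p.2 q.2 else 0) -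
          (if p.1 = q.1 + 1 then (projP L₂ * link2R' A q.1) p.2 q.2 else 0) := by
  have hsw0 : Equiv.swap (0 : Fin 4) 2 0 = 2 := by decide
  have hsw1 : Equiv.swap (0 : Fin 4) 2 1 = 1 := by decide
  have hsw2 : Equiv.swap (0 : Fin 4) 2 2 = 0 := by decide
  have hsw3 : Equiv.swap (0 : Fin 4) 2 3 = 3 := by decide
  have hPmW : ∀ t, projM L₂ * link2R A t = Matrix.of fun a b : ZMod L₂ × Fin 3 × Fin 4 => if a.1 = b.1 then
      ((1 / 2 : ℂ) • (1 - euclideanGamma 0)) a.2.2 b.2.2 *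
        ((if t = -1 then (-1 : ℂ) else 1) • (A t a.1 2 : Matrix (Fin 3) (Fin 3) ℂ)) a.2.1 b.2.1 else 0 := fun t =>
    TimeSlice.spinLift_mul_colourLift _ (fun x => (if t = -1 then (-1 : ℂ) else 1) • (A t x 2 : Matrix (Fin 3) (Fin 3) ℂ))
  have hPpW' : ∀ t, projP L₂ * link2R' A t = Matrix.of fun a b : ZMod L₂ × Fin 3 × Fin 4 => if a.1 = b.1 then
      ((1 / 2 : ℂ) • (1 + euclideanGamma 0)) a.2.2 b.2.2 *
        ((if t = -1 then (-1 : ℂ) else 1) • (star (A t a.1 2 : Matrix (Fin 3) (Fin 3) ℂ))) a.2.1 b.2.1 else 0 :=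
    fun t => TimeSlice.spinLift_mul_colourLift _
      (fun x => (if t = -1 then (-1 : ℂ) else 1) • (star (A t x 2 : Matrix (Fin 3) (Fin 3) ℂ)))
  ext ⟨t, x, c, α⟩ ⟨s, y, d, β⟩
  simp only [Matrix.submatrix_apply, Matrix.of_apply, hPmW, hPpW', sliceOpR_apply]
  simp only [tfreqOpR, freqOpR, Matrix.of_apply, hsw0, hsw1, hsw2, hsw3, Prod.mk.injEq, Matrix.smul_apply, smul_eq_mul]
  by_cases hst : s = t
  · subst hst
    by_cases hxy : y = x
    · subst hxy
      simp only [true_and, and_true, and_self, if_true]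
      split_ifs <;> ring
    · simp only [hxy, Ne.symm hxy, true_and, false_and, and_false, if_true, if_false]
      split_ifs <;> ring
  · by_cases hxy : y = x
    · subst hxy
      simp only [hst, Ne.symm hst, true_and, and_true, false_and, if_true, if_false]
      split_ifs <;> ring
    · simp only [hst, Ne.symm hst, hxy, Ne.symm hxy, false_and, and_false, if_false]
      split_ifs <;> ring

/-! ### The spin structure of the slice data -/

/-- Kronecker form of the forward temporal transporter. -/
theorem link2R_eq {L₁ L₂ : ℕ} [NeZero L₁] [NeZero L₂] (A : ZMod L₁ → ZMod L₂ → Fin 4 → Matrix.unitaryGroup (Fin 3) ℂ) (t : ZMod L₁) :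
    link2R A t = Matrix.reindexAlgEquiv ℂ ℂ (Equiv.prodAssoc (ZMod L₂) (Fin 3) (Fin 4))
      ((Matrix.of fun p q : ZMod L₂ × Fin 3 => if p.1 = q.1 then
          ((if t = -1 then (-1 : ℂ) else 1) • (A t p.1 2 : Matrix (Fin 3) (Fin 3) ℂ)) p.2 q.2 else 0) ⊗ₖ
        (1 : Matrix (Fin 4) (Fin 4) ℂ)) :=
  SliceSpin.of_colour_eq fun x => (if t = -1 then (-1 : ℂ) else 1) • (A t x 2 : Matrix (Fin 3) (Fin 3) ℂ)

/-- Kronecker form of the backward temporal transporter. -/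
theorem link2R'_eq {L₁ L₂ : ℕ} [NeZero L₁] [NeZero L₂] (A : ZMod L₁ → ZMod L₂ → Fin 4 → Matrix.unitaryGroup (Fin 3) ℂ) (t : ZMod L₁) :
    link2R' A t = Matrix.reindexAlgEquiv ℂ ℂ (Equiv.prodAssoc (ZMod L₂) (Fin 3) (Fin 4))
      ((Matrix.of fun p q : ZMod L₂ × Fin 3 => if p.1 = q.1 then
          ((if t = -1 then (-1 : ℂ) else 1) • (star (A t p.1 2 : Matrix (Fin 3) (Fin 3) ℂ))) p.2 q.2 else 0) ⊗ₖ
        (1 : Matrix (Fin 4) (Fin 4) ℂ)) :=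
  SliceSpin.of_colour_eq fun x => (if t = -1 then (-1 : ℂ) else 1) • (star (A t x 2 : Matrix (Fin 3) (Fin 3) ℂ))

/-- The seam-signed temporal links are unitary: `(σ_t A⁻¹)(σ_t A) = 1` colour block by colour block. -/
theorem signedLink_inv_mulR {L₁ L₂ : ℕ} (A : ZMod L₁ → ZMod L₂ → Fin 4 → Matrix.unitaryGroup (Fin 3) ℂ) (t : ZMod L₁) (x : ZMod L₂) :
    (if t = -1 then (-1 : ℂ) else 1) • (star (A t x 2 : Matrix (Fin 3) (Fin 3) ℂ)) *
        ((if t = -1 then (-1 : ℂ) else 1) • (A t x 2 : Matrix (Fin 3) (Fin 3) ℂ)) = 1 := by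
  have hU : star (A t x 2 : Matrix (Fin 3) (Fin 3) ℂ) * (A t x 2 : Matrix (Fin 3) (Fin 3) ℂ) = 1 :=
    Matrix.mem_unitaryGroup_iff'.mp (A t x 2).2
  by_cases ht : t = -1 <;> simp [ht, hU]

/-- **The nine commutation claims** of `wilsonSlice_spin_structure` for the slice data of the time form:
`P⁻A_tP⁻ = B̂_tP⁻`, `B̂_t` commutes with `P±`, `det B̂_t = (det B_t)⁴`, `W_t`, `W′_t` commute with `P±`, `W′_tW_t = 1`. -/
theorem slice_spin_structureR {L₁ L₂ : ℕ} [NeZero L₁] [NeZero L₂] (A : ZMod L₁ → ZMod L₂ → Fin 4 → Matrix.unitaryGroup (Fin 3) ℂ)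
    (m ω₀ ω₁ : ℝ) (t : ZMod L₁) :
    projM L₂ * sliceOpR A m ω₀ ω₁ t * projM L₂ = sliceBhR A m ω₀ ω₁ t * projM L₂ ∧
      sliceBhR A m ω₀ ω₁ t * projM L₂ = projM L₂ * sliceBhR A m ω₀ ω₁ t ∧
      sliceBhR A m ω₀ ω₁ t * projP L₂ = projP L₂ * sliceBhR A m ω₀ ω₁ t ∧
      (sliceBhR A m ω₀ ω₁ t).det = (massHopR A m ω₀ ω₁ t).det ^ 4 ∧
      link2R A t * projP L₂ = projP L₂ * link2R A t ∧ link2R A t * projM L₂ = projM L₂ * link2R A t ∧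
      link2R' A t * projP L₂ = projP L₂ * link2R' A t ∧ link2R' A t * projM L₂ = projM L₂ * link2R' A t ∧
      link2R' A t * link2R A t = 1 := by
  have h := SliceSpin.kronecker_claims (massHopR A m ω₀ ω₁ t)
    (Matrix.of fun p q : ZMod L₂ × Fin 3 => if p.1 = q.1 then
      ((if t = -1 then (-1 : ℂ) else 1) • (A t p.1 2 : Matrix (Fin 3) (Fin 3) ℂ)) p.2 q.2 else 0)
    (Matrix.of fun p q : ZMod L₂ × Fin 3 => if p.1 = q.1 then
      ((if t = -1 then (-1 : ℂ) else 1) • (star (A t p.1 2 : Matrix (Fin 3) (Fin 3) ℂ))) p.2 q.2 else 0)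
    (hopCoeffR A ω₀ ω₁ t)
    (SliceSpin.of_colour_mul_of_colour_eq_one
      (fun x => (if t = -1 then (-1 : ℂ) else 1) • (star (A t x 2 : Matrix (Fin 3) (Fin 3) ℂ)))
      (fun x => (if t = -1 then (-1 : ℂ) else 1) • (A t x 2 : Matrix (Fin 3) (Fin 3) ℂ)) (signedLink_inv_mulR A t))
  rw [projP_eq, projM_eq, link2R_eq, link2R'_eq]
  unfold sliceOpR sliceBhR
  exact h

/-- The hop along the second coordinate is an isometry: `H_tᴴ H_t = 1`. -/
theorem conjTranspose_mul_hop3R {L₁ L₂ : ℕ} [NeZero L₁] [NeZero L₂] (A : ZMod L₁ → ZMod L₂ → Fin 4 → Matrix.unitaryGroup (Fin 3) ℂ)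
    (t : ZMod L₁) : (hop3R A t)ᴴ * hop3R A t = 1 := by
  refine SliceMassHop.conjTranspose_mul_blockPermHop (fun x : ZMod L₂ => x + 1) (add_left_injective 1)
    (fun x => (if x = -1 then (-1 : ℂ) else 1) • (A t x 3 : Matrix (Fin 3) (Fin 3) ℂ)) fun y => ?_
  have hU : (A t y 3 : Matrix (Fin 3) (Fin 3) ℂ) * (A t y 3 : Matrix (Fin 3) (Fin 3) ℂ)ᴴ = 1 := by
    simpa only [Matrix.star_eq_conjTranspose] using Matrix.mem_unitaryGroup_iff.mp (A t y 3).2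
  split_ifs <;> simp [hU]

/-- **Positivity of the spin-blind slice operator** `B_t = M_ω·1 − ½(H_t + H_tᴴ)` for `m > −1`: the hop is an
isometry and `M_ω = m + 4 − cos ω₀ − cos ω₁ > 1` (`SliceMassHopPosDef.posDef_diagonal_sub_hopSum`). -/
theorem massHopR_posDef {L₁ L₂ : ℕ} [NeZero L₁] [NeZero L₂] (A : ZMod L₁ → ZMod L₂ → Fin 4 → Matrix.unitaryGroup (Fin 3) ℂ) {m : ℝ}
    (hm : -1 < m) (ω₀ ω₁ : ℝ) (t : ZMod L₁) : (massHopR A m ω₀ ω₁ t).PosDef := by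
  have h := SliceMassHopPosDef.posDef_diagonal_sub_hopSum (fun _ : Fin 1 => hop3R A t)
    (fun _ => conjTranspose_mul_hop3R A t) (fun _ : ZMod L₂ × Fin 3 => m + 4 - Real.cos ω₀ - Real.cos ω₁)
    (fun _ => by
      rw [Fintype.card_fin]
      push_cast
      linarith [Real.cos_le_one ω₀, Real.cos_le_one ω₁])
  rw [Fin.sum_univ_one] at h
  exact h

/-- The coefficients `C_{t,j}` are anti-Hermitian. -/
theorem hopCoeffR_conjTranspose {L₁ L₂ : ℕ} [NeZero L₁] [NeZero L₂] (A : ZMod L₁ → ZMod L₂ → Fin 4 → Matrix.unitaryGroup (Fin 3) ℂ)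
    (ω₀ ω₁ : ℝ) (t : ZMod L₁) : ∀ j, (hopCoeffR A ω₀ ω₁ t j)ᴴ = -hopCoeffR A ω₀ ω₁ t j := by
  intro j
  fin_cases j
  · show ((Complex.I * ((Real.sin ω₁ : ℝ) : ℂ)) • (1 : Matrix (ZMod L₂ × Fin 3) (ZMod L₂ × Fin 3) ℂ))ᴴ = _
    rw [conjTranspose_smul, conjTranspose_one]
    show _ = -((Complex.I * ((Real.sin ω₁ : ℝ) : ℂ)) • (1 : Matrix (ZMod L₂ × Fin 3) (ZMod L₂ × Fin 3) ℂ))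
    rw [← neg_smul, star_mul', Complex.star_def, Complex.conj_I, Complex.conj_ofReal, neg_mul]
  · show ((Complex.I * ((Real.sin ω₀ : ℝ) : ℂ)) • (1 : Matrix (ZMod L₂ × Fin 3) (ZMod L₂ × Fin 3) ℂ))ᴴ = _
    rw [conjTranspose_smul, conjTranspose_one]
    show _ = -((Complex.I * ((Real.sin ω₀ : ℝ) : ℂ)) • (1 : Matrix (ZMod L₂ × Fin 3) (ZMod L₂ × Fin 3) ℂ))
    rw [← neg_smul, star_mul', Complex.star_def, Complex.conj_I, Complex.conj_ofReal, neg_mul]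
  · show ((1 / 2 : ℂ) • (hop3R A t - (hop3R A t)ᴴ))ᴴ = -((1 / 2 : ℂ) • (hop3R A t - (hop3R A t)ᴴ))
    rw [conjTranspose_smul, conjTranspose_sub, conjTranspose_conjTranspose, TimeKernelPosDef.star_one_half, ← smul_neg,
      neg_sub]

/-- **The five positivity claims** of `WilsonTransfer.slice_claims` for the slice data of the time form (`m > −1`):
`P⁺A_tP⁺ = B̂_tP⁺`, `(A_t − B̂_t)ᴴ = −(A_t − B̂_t)`, `P±ᴴ = P±`, `B̂_t > 0`. -/
theorem slice_claimsR {L₁ L₂ : ℕ} [NeZero L₁] [NeZero L₂] (A : ZMod L₁ → ZMod L₂ → Fin 4 → Matrix.unitaryGroup (Fin 3) ℂ) {m : ℝ}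
    (hm : -1 < m) (ω₀ ω₁ : ℝ) (t : ZMod L₁) :
    projP L₂ * sliceOpR A m ω₀ ω₁ t * projP L₂ = sliceBhR A m ω₀ ω₁ t * projP L₂ ∧
      (sliceOpR A m ω₀ ω₁ t - sliceBhR A m ω₀ ω₁ t)ᴴ = -(sliceOpR A m ω₀ ω₁ t - sliceBhR A m ω₀ ω₁ t) ∧
      (projP L₂)ᴴ = projP L₂ ∧ (projM L₂)ᴴ = projM L₂ ∧ (sliceBhR A m ω₀ ω₁ t).PosDef := by
  rw [projP_eq, projM_eq]
  exact WilsonTransfer.kronecker_claims_plus (massHopR A m ω₀ ω₁ t) (hopCoeffR A ω₀ ω₁ t)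
    (hopCoeffR_conjTranspose A ω₀ ω₁ t) (massHopR_posDef A hm ω₀ ω₁ t)

/-- `det B̂_t` is a unit for `m > −1`. -/
theorem isUnit_det_sliceBhR {L₁ L₂ : ℕ} [NeZero L₁] [NeZero L₂] (A : ZMod L₁ → ZMod L₂ → Fin 4 → Matrix.unitaryGroup (Fin 3) ℂ) {m : ℝ}
    (hm : -1 < m) (ω₀ ω₁ : ℝ) (t : ZMod L₁) : IsUnit (sliceBhR A m ω₀ ω₁ t).det := by
  rw [(slice_spin_structureR A m ω₀ ω₁ t).2.2.2.1]
  exact ((Matrix.isUnit_iff_isUnit_det _).mp (massHopR_posDef A hm ω₀ ω₁ t).isUnit).pow 4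

/-! ### The time-slice reduction of the frequency determinant -/

/-- **Time-slice reduction** of the 2D frequency determinant (`det_projChain` applied to the time form):
`det tfreqOpR = (∏_t det E_t) · det(1 − (−1)^{L₁} ∏_{t<L₁} E_t⁻¹ F_t)` with `E_t = A_tP⁻ − P⁺W′_{t−1}`, `F_t = A_tP⁺ − P⁻W_t`. -/
theorem tfreqOpR_det_slice_reduction {L₁ L₂ : ℕ} [NeZero L₁] [NeZero L₂] (A : ZMod L₁ → ZMod L₂ → Fin 4 → Matrix.unitaryGroup (Fin 3) ℂ)
    {m : ℝ} (hm : -1 < m) (ω₀ ω₁ : ℝ) :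
    (tfreqOpR A m ω₀ ω₁).det =
      (∏ t : ZMod L₁, (sliceOpR A m ω₀ ω₁ t * projM L₂ - projP L₂ * link2R' A (t - 1)).det) *
        (1 - (-1 : ℂ) ^ L₁ •
          ((List.range L₁).map fun i : ℕ =>
            (sliceOpR A m ω₀ ω₁ (i : ZMod L₁) * projM L₂ - projP L₂ * link2R' A ((i : ZMod L₁) - 1))⁻¹ *
              (sliceOpR A m ω₀ ω₁ (i : ZMod L₁) * projP L₂ - projM L₂ * link2R A (i : ZMod L₁))).prod).det := by
  have hspin := fun t : ZMod L₁ => slice_spin_structureR A m ω₀ ω₁ t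
  have hchain := det_projChain L₁ (ZMod L₂) 3 (sliceOpR A m ω₀ ω₁) (link2R A) (link2R' A)
    (fun t => (hspin t).2.2.2.2.1) (fun t => (hspin t).2.2.2.2.2.1)
    (fun t => (hspin t).2.2.2.2.2.2.1) (fun t => (hspin t).2.2.2.2.2.2.2.1)
    (fun t => by
      obtain ⟨-, -, -, -, -, -, hW'p, -, hW'W⟩ := hspin (t - 1)
      obtain ⟨hPAP', hBP', -, -, -, -, -, -, -⟩ := hspin t
      exact isUnit_det_projChainBlock (ZMod L₂ × Fin 3 × Fin 4) (sliceOpR A m ω₀ ω₁ t) _ (link2R' A (t - 1)) (projP L₂)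
        (projM L₂) (liftProjPlus_add_liftProjMinus (ZMod L₂) 3) (liftProjPlus_mul_liftProjMinus (ZMod L₂) 3)
        (liftProjMinus_mul_liftProjPlus (ZMod L₂) 3) hPAP' hBP' (isUnit_det_sliceBhR A hm ω₀ ω₁ t) hW'p
        (Matrix.isUnit_det_of_right_inverse hW'W))
  have hdet : (tfreqOpR A m ω₀ ω₁).det =
      ((tfreqOpR A m ω₀ ω₁).submatrix (fun p : ZMod L₁ × (ZMod L₂ × Fin 3 × Fin 4) => ((p.1, p.2.1), p.2.2))
        (fun p : ZMod L₁ × (ZMod L₂ × Fin 3 × Fin 4) => ((p.1, p.2.1), p.2.2))).det :=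
    (Matrix.det_submatrix_equiv_self (Equiv.prodAssoc (ZMod L₁) (ZMod L₂) (Fin 3 × Fin 4)).symm _).symm
  rw [hdet, tfreqOpR_submatrix_timeSlice]
  exact hchain

/-! ### Lüscher's transfer-matrix form of the frequency determinant -/

/-- **Lüscher's transfer-matrix form of the 2D frequency determinant** (the pipeline of `wilson_det_transfer_form`
run on the rectangular time form): for `m > −1`, `det tfreqOpR = (∏_t det E_t) · det(1 − ∏_{t<L₁} M_t W_t)` with every dressed
one-step matrix `M_t = oneStepR A m ω₀ ω₁ t` Hermitian positive definite and `W_t = link2R A t` the seam-signed unitary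
temporal transporters. -/
theorem tfreqOpR_det_transfer_form {L₁ L₂ : ℕ} [NeZero L₁] [NeZero L₂] (A : ZMod L₁ → ZMod L₂ → Fin 4 → Matrix.unitaryGroup (Fin 3) ℂ)
    {m : ℝ} (hm : -1 < m) (ω₀ ω₁ : ℝ) :
    (tfreqOpR A m ω₀ ω₁).det =
        (∏ t : ZMod L₁, (sliceOpR A m ω₀ ω₁ t * projM L₂ - projP L₂ * link2R' A (t - 1)).det) *
          (1 - ((List.range L₁).map fun i : ℕ => oneStepR A m ω₀ ω₁ (i : ZMod L₁) * link2R A (i : ZMod L₁)).prod).det ∧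
      ∀ t : ZMod L₁, (oneStepR A m ω₀ ω₁ t).PosDef := by
  -- adapted from `wilson_det_transfer_form` (…StableActionBridgeWilsonTransferForm.lean)
  have hP : projP L₂ + projM L₂ = 1 := liftProjPlus_add_liftProjMinus (ZMod L₂) 3
  have hPQ : projP L₂ * projM L₂ = 0 := liftProjPlus_mul_liftProjMinus (ZMod L₂) 3
  have hQP : projM L₂ * projP L₂ = 0 := liftProjMinus_mul_liftProjPlus (ZMod L₂) 3
  have hPP : projP L₂ * projP L₂ = projP L₂ := WilsonTransfer.mul_self_of_add_eq_one hP hPQ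
  have hQQ : projM L₂ * projM L₂ = projM L₂ := WilsonTransfer.mul_self_of_add_eq_one ((add_comm _ _).trans hP) hQP
  have hspin := fun t : ZMod L₁ => slice_spin_structureR A m ω₀ ω₁ t
  have hplus := fun t : ZMod L₁ => slice_claimsR A hm ω₀ ω₁ t
  have hdetBh : ∀ t : ZMod L₁, IsUnit (sliceBhR A m ω₀ ω₁ t).det := fun t => isUnit_det_sliceBhR A hm ω₀ ω₁ t
  have hCpp : ∀ t : ZMod L₁, projP L₂ * (sliceOpR A m ω₀ ω₁ t - sliceBhR A m ω₀ ω₁ t) * projP L₂ = 0 := fun t =>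
    WilsonTransfer.proj_sub_proj_eq_zero (hplus t).1 (hspin t).2.2.1 hPP
  have hCmm : ∀ t : ZMod L₁, projM L₂ * (sliceOpR A m ω₀ ω₁ t - sliceBhR A m ω₀ ω₁ t) * projM L₂ = 0 := fun t =>
    WilsonTransfer.proj_sub_proj_eq_zero (hspin t).1 (hspin t).2.1 hQQ
  -- the explicit inverse of the chain block
  have hEinv : ∀ t : ZMod L₁, (sliceOpR A m ω₀ ω₁ t * projM L₂ - projP L₂ * link2R' A (t - 1))⁻¹ =
      -(link2R A (t - 1) * projP L₂) +
        link2R A (t - 1) * projP L₂ * (sliceOpR A m ω₀ ω₁ t - sliceBhR A m ω₀ ω₁ t) * (sliceBhR A m ω₀ ω₁ t)⁻¹ * projM L₂ +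
        (sliceBhR A m ω₀ ω₁ t)⁻¹ * projM L₂ := fun t => by
    refine Matrix.inv_eq_right_inv ?_
    have h := projChainBlock_mul_explicitInv _ (projP L₂) (projM L₂) (sliceBhR A m ω₀ ω₁ t)
      (sliceOpR A m ω₀ ω₁ t - sliceBhR A m ω₀ ω₁ t) (link2R A (t - 1)) (link2R' A (t - 1)) hP hPP hQQ hPQ hQP
      (hspin t).2.2.1 (hspin t).2.1 (hCmm t) (hspin (t - 1)).2.2.2.2.2.2.1 (hspin (t - 1)).2.2.2.2.2.1
      (hspin (t - 1)).2.2.2.2.2.2.2.2 (hdetBh t)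
    rwa [add_sub_cancel] at h
  -- the dressed one-step matrices
  have hstep : ∀ t : ZMod L₁, (sliceOpR A m ω₀ ω₁ t * projM L₂ - projP L₂ * link2R' A (t - 1))⁻¹ *
      (sliceOpR A m ω₀ ω₁ t * projP L₂ - projM L₂ * link2R A t) =
      -((link2R A (t - 1) * projP L₂ + projM L₂) * oneStepR A m ω₀ ω₁ t * (projP L₂ + link2R A t * projM L₂)) := fun t => by
    rw [hEinv t]
    have h := neg_explicitInv_mul_eq_dressed_two _ (projP L₂) (projM L₂) (sliceBhR A m ω₀ ω₁ t)
      (sliceOpR A m ω₀ ω₁ t - sliceBhR A m ω₀ ω₁ t) (link2R A (t - 1)) (link2R A t) hPP hQQ hPQ hQP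
      (hspin t).2.2.1 (hspin t).2.1 (hCpp t) (hspin t).2.2.2.2.2.1 (hdetBh t)
    rw [add_sub_cancel] at h
    rw [oneStepR, ← h, neg_neg]
  -- the product of the one-step matrices
  have hprod : (-1 : ℂ) ^ L₁ •
      ((List.range L₁).map fun i : ℕ =>
        (sliceOpR A m ω₀ ω₁ (i : ZMod L₁) * projM L₂ - projP L₂ * link2R' A ((i : ZMod L₁) - 1))⁻¹ *
          (sliceOpR A m ω₀ ω₁ (i : ZMod L₁) * projP L₂ - projM L₂ * link2R A (i : ZMod L₁))).prod =
      ((List.range L₁).map fun i : ℕ =>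
        (link2R A ((i : ZMod L₁) - 1) * projP L₂ + projM L₂) * oneStepR A m ω₀ ω₁ i * (projP L₂ + link2R A i * projM L₂)).prod := by
    have hf : (fun i : ℕ => (sliceOpR A m ω₀ ω₁ (i : ZMod L₁) * projM L₂ - projP L₂ * link2R' A ((i : ZMod L₁) - 1))⁻¹ *
          (sliceOpR A m ω₀ ω₁ (i : ZMod L₁) * projP L₂ - projM L₂ * link2R A (i : ZMod L₁))) =
        fun i : ℕ => -((link2R A ((i : ZMod L₁) - 1) * projP L₂ + projM L₂) * oneStepR A m ω₀ ω₁ i *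
          (projP L₂ + link2R A i * projM L₂)) :=
      funext fun i => hstep i
    rw [hf, WilsonTransfer.prod_map_neg_eq_smul (fun i : ℕ => (link2R A ((i : ZMod L₁) - 1) * projP L₂ + projM L₂) *
      oneStepR A m ω₀ ω₁ i * (projP L₂ + link2R A i * projM L₂)) (List.range L₁), List.length_range, smul_smul, ← mul_pow,
      neg_mul_neg, one_mul, one_pow, one_smul]
  -- the time-slice reduction and the cyclic undressing
  have hred := tfreqOpR_det_slice_reduction A hm ω₀ ω₁
  have hcyc := det_one_sub_smul_prod_dressed _ L₁ 1 (projP L₂) (projM L₂) (oneStepR A m ω₀ ω₁) (link2R A) hP hPP hQQ hPQ hQP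
    (fun t => (hspin t).2.2.2.2.1) (fun t => (hspin t).2.2.2.2.2.1)
  rw [one_smul, one_smul] at hcyc
  refine ⟨?_, fun t => ?_⟩
  · rw [hred, hprod, hcyc]
  · exact dressedCore_posDef _ (projP L₂) (projM L₂) (sliceBhR A m ω₀ ω₁ t) (sliceOpR A m ω₀ ω₁ t - sliceBhR A m ω₀ ω₁ t)
      hP hPP hQQ hPQ hQP (hplus t).2.2.1 (hplus t).2.2.2.1 (hspin t).2.2.1 (hspin t).2.1 (hplus t).2.1 (hplus t).2.2.2.2

end FrequencyDiamagnetism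

/-! ### Registered auxiliary theorem -/

/-- **Aux stub `rectTransferForm`** (Lüscher's transfer-matrix form of the 2D frequency determinant on the rectangular
two-torus `ℤ/L₁ × ℤ/L₂`): for every field `A : ℤ/L₁ → ℤ/L₂ → Fin 4 → U(3)`, `m > −1` and real frequency pair, the determinant
of the time form `tfreqOpR A m ω₀ ω₁` (`= det freqOpR γ A` by `det_tfreqOpR`) is `(∏_{t : ℤ/L₁} det E_t) · det(1 − ∏_{t<L₁} M_t W_t)`
with positive definite dressed one-step matrices `M_t` and seam-signed unitary temporal transporters `W_t`. -/
theorem rectTransferForm : ∀ (L₁ L₂ : ℕ) [NeZero L₁] [NeZero L₂] (A : ZMod L₁ → ZMod L₂ → Fin 4 → Matrix.unitaryGroup (Fin 3) ℂ) (m : ℝ), -1 < m → ∀ ω₀ ω₁ : ℝ, (FrequencyDiamagnetism.tfreqOpR A m ω₀ ω₁).det = (∏ t : ZMod L₁, (FrequencyDiamagnetism.sliceOpR A m ω₀ ω₁ t * FrequencyDiamagnetism.projM L₂ - FrequencyDiamagnetism.projP L₂ * FrequencyDiamagnetism.link2R' A (t - 1)).det) * (1 - ((List.range L₁).map fun i :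 ℕ => FrequencyDiamagnetism.oneStepR A m ω₀ ω₁ (i : ZMod L₁) * FrequencyDiamagnetism.link2R A (i : ZMod L₁)).prod).det ∧ ∀ t : ZMod L₁, (FrequencyDiamagnetism.oneStepR A m ω₀ ω₁ t).PosDef :=
  fun _ _ _ _ A _ hm ω₀ ω₁ => FrequencyDiamagnetism.tfreqOpR_det_transfer_form A hm ω₀ ω₁

end Summit.QuantumFields.QCD.Cruxes.CriticalLineDiamagnetism.ChessboardCellGain

end
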